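import Summits.AtomisticToContinuum.Crystallization.Theorems.FrustratedLawDichotomyThirteenthNeighbourGap

/-!
# FrustratedLawDichotomy · crux `AperiodicFrustratedLawGap` (stmt-AtomisticToContinuum-27623) — KR_gap FOR THE HCP PATTERN: the covering
# constant of the anticuboctahedron (decomp-a2c, prover hand 2, structural share, generation 7; route-independent module)

Sequel of `FrustratedLawDichotomyThirteenthNeighbourGap` (fcc).  The hcp kissing pattern (anticuboctahedron, `Literature…hcpKissingPattern` =
`hcpInt/√18`: the hexagon `H` of `(±3,∓3,0)`-type vectors, the top triangle `T = {(3,3,0),(3,0,3),(0,3,3)}` and its mirror image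
`B = {(−1,−1,−4),(−1,−4,−1),(−4,−1,−1)}` in the hexagonal plane `x+y+z = 0`) has the same covering constant `45°` as the cuboctahedron:

* `hcp_covering` : for every `x ∈ ℝ³` and `d ≥ 0` some hcp pattern vector `u` has `‖x − d•u‖² ≤ ‖x‖² + d² − √2·d·‖x‖`.
  Proof: for `x` in the upper half-space `x₀+x₁+x₂ ≥ 0` the cuboctahedral choice (signs of the two coordinates of largest modulus) never uses
  two minus signs, so it lies in `H ∪ T ⊆ hcp`; for the lower half-space apply the mirror `σ(x) = x − (2/3)(x₀+x₁+x₂)(1,1,1)`, an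
  involutive linear isometry fixing `H` and exchanging `T` and `B`.
* `thirteenth_neighbour_gap_hcp` : KR_gap for hcp shells (from the pattern-generic `thirteenth_neighbour_gap`).

With the fcc file this completes KR_gap for both patterns of the crux's goodness predicate; KR_shape (twelve `1/100`-bonds of ring number `4`
⟹ an fcc/hcp shell within `η < 1/20`) remains the census-facing finite-dimensional residual of the `ChargedEnergyGap` concordance edge.  `[folklore]`.
-/

noncomputable section

namespace Summit.AtomisticToContinuum.Crystallization.Theorems.FrustratedLawDichotomyThirteenthNeighbourGapHcp

open Literature.Geometry.DiscreteGeometry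
open Summit.AtomisticToContinuum.Crystallization.Theorems.FrustratedLawDichotomyThirteenthNeighbourGap
  (exists_sign covering_aux thirteenth_neighbour_gap)
open Literature.Algebra.EuclideanLattices (norm_sq_fin_three)

/-- The nine «upper» cuboctahedral vectors (hexagon and top triangle), shared with the hcp pattern after scaling by `3`. [folklore] -/
theorem three_smul_mem_hcpInt (s₀ s₁ : ℤ) (h₀ : s₀ = 1 ∨ s₀ = -1) (h₁ : s₁ = 1 ∨ s₁ = -1) (hne : ¬ (s₀ = -1 ∧ s₁ = -1)) :
    ![3 * s₀, 3 * s₁, 0] ∈ hcpInt ∧ ![3 * s₀, 0, 3 * s₁] ∈ hcpInt ∧ ![0, 3 * s₀, 3 * s₁] ∈ hcpInt := by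
  rcases h₀ with rfl | rfl <;> rcases h₁ with rfl | rfl <;> first | exact absurd ⟨rfl, rfl⟩ hne | decide

/-- Coordinates of a scaled integer vector of the hcp pattern: `((√18)⁻¹ • intVec v) i = (√2)⁻¹ * (v i / 3)` (`√18 = 3√2`, cf.
`PhononSlackCertificatesNearFarGlueR.sqrt_eighteen_nat`, whose module is outside this import cone). [folklore] -/
theorem hcp_coord (v : Fin 3 → ℤ) (i : Fin 3) :
    ((Real.sqrt ((18 : ℕ) : ℝ))⁻¹ • intVec v : EuclideanSpace ℝ (Fin 3)) i = (Real.sqrt 2)⁻¹ * ((v i : ℝ) / 3) := by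
  have h18 : Real.sqrt ((18 : ℕ) : ℝ) = 3 * Real.sqrt 2 := by
    rw [show ((18 : ℕ) : ℝ) = 3 ^ 2 * 2 by norm_num, Real.sqrt_mul (by norm_num), Real.sqrt_sq (by norm_num)]
  rw [PiLp.smul_apply, smul_eq_mul, intVec_apply, h18, mul_inv]
  ring

/-- **The upper half-space**: if `x₀ + x₁ + x₂ ≥ 0`, `|x_k|` is minimal and `s_i x_i = |x_i|` for the other two coordinates with `s_i = ±1`,
then not both `s_i = −1` (sign convention `s = 1` at `0`: `s_i = -1 → x_i < 0`). [folklore] -/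
theorem not_both_neg {a b c : ℝ} {s t : ℤ} (hsum : 0 ≤ a + b + c) (hca : |c| ≤ |a|)
    (hs : s = -1 → a < 0) (ht : t = -1 → b < 0) : ¬ (s = -1 ∧ t = -1) := by
  rintro ⟨hs', ht'⟩
  have ha := hs hs'
  have hb := ht ht'
  have h1 : |a| = -a := abs_of_neg ha
  have h2 : |b| = -b := abs_of_neg hb
  have hc : c ≤ |c| := le_abs_self c
  rcases le_total (-a) (-b) with h | h
  · linarith
  · linarith

/-- A sign `s ∈ {±1}` with `s·t = |t|`, `s² = 1`, and `s = −1` only when `t < 0`. [folklore] -/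
theorem exists_sign' (t : ℝ) : ∃ s : ℤ, (s = 1 ∨ s = -1) ∧ (s : ℝ) * t = |t| ∧ ((s : ℝ)) ^ 2 = 1 ∧ (s = -1 → t < 0) := by
  by_cases h : 0 ≤ t
  · exact ⟨1, Or.inl rfl, by rw [abs_of_nonneg h]; simp, by simp, fun h1 => by norm_num at h1⟩
  · exact ⟨-1, Or.inr rfl, by rw [abs_of_neg (not_le.1 h)]; simp, by simp, fun _ => not_le.1 h⟩

/-- **Upper half-space covering by `H ∪ T`**: for `x₀+x₁+x₂ ≥ 0` some hcp vector of the form `(3s₀,3s₁,0)/√18` (up to the position of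
the zero) does the job. [folklore] -/
theorem hcp_covering_upper (x : EuclideanSpace ℝ (Fin 3)) (hx : 0 ≤ x 0 + x 1 + x 2) {d : ℝ} (hd : 0 ≤ d) :
    ∃ u ∈ hcpKissingPattern, ‖x - d • u‖ ^ 2 ≤ ‖x‖ ^ 2 + d ^ 2 - Real.sqrt 2 * d * ‖x‖ := by
  have hnorm : ‖x‖ = Real.sqrt (x 0 ^ 2 + x 1 ^ 2 + x 2 ^ 2) := by
    rw [← norm_sq_fin_three, Real.sqrt_sq (norm_nonneg _)]
  have cand : ∀ v : Fin 3 → ℤ, v ∈ hcpInt →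
      ‖x - d • ((Real.sqrt ((18 : ℕ) : ℝ))⁻¹ • intVec v)‖ ^ 2 =
        (x 0 - d * ((Real.sqrt 2)⁻¹ * ((v 0 : ℝ) / 3))) ^ 2 + (x 1 - d * ((Real.sqrt 2)⁻¹ * ((v 1 : ℝ) / 3))) ^ 2 +
          (x 2 - d * ((Real.sqrt 2)⁻¹ * ((v 2 : ℝ) / 3))) ^ 2 := by
    intro v _
    rw [norm_sq_fin_three]
    simp only [PiLp.sub_apply, PiLp.smul_apply _ d, smul_eq_mul, hcp_coord]
  have mem : ∀ v : Fin 3 → ℤ, v ∈ hcpInt → (Real.sqrt ((18 : ℕ) : ℝ))⁻¹ • intVec v ∈ hcpKissingPattern :=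
    fun v hv => Finset.mem_image_of_mem _ hv
  have e2 : ∀ a b c : ℤ, ((![a, b, c] : Fin 3 → ℤ) 0 = a) ∧ ((![a, b, c] : Fin 3 → ℤ) 1 = b) ∧ ((![a, b, c] : Fin 3 → ℤ) 2 = c) :=
    fun a b c => ⟨rfl, rfl, rfl⟩
  have htri : (|x 2| ≤ |x 0| ∧ |x 2| ≤ |x 1|) ∨ (|x 1| ≤ |x 0| ∧ |x 1| ≤ |x 2|) ∨ (|x 0| ≤ |x 1| ∧ |x 0| ≤ |x 2|) := by
    rcases le_total |x 2| |x 1| with h | h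
    · rcases le_total |x 2| |x 0| with h' | h'
      · exact Or.inl ⟨h', h⟩
      · exact Or.inr (Or.inr ⟨h'.trans h, h'⟩)
    · rcases le_total |x 1| |x 0| with h' | h'
      · exact Or.inr (Or.inl ⟨h', h⟩)
      · exact Or.inr (Or.inr ⟨h', h'.trans h⟩)
  obtain ⟨s₀, hs₀, hs₀x, hs₀sq, hs₀n⟩ := exists_sign' (x 0)
  obtain ⟨s₁, hs₁, hs₁x, hs₁sq, hs₁n⟩ := exists_sign' (x 1)
  obtain ⟨s₂, hs₂, hs₂x, hs₂sq, hs₂n⟩ := exists_sign' (x 2)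
  have c3 : ∀ s : ℤ, (((3 * s : ℤ) : ℝ) / 3) = (s : ℝ) := fun s => by push_cast; ring
  have c0 : (((0 : ℤ) : ℝ) / 3) = 0 := by simp
  rcases htri with hA | hB | hC
  · have hne := not_both_neg hx hA.1 hs₀n hs₁n
    obtain ⟨hw, -, -⟩ := three_smul_mem_hcpInt _ _ hs₀ hs₁ hne
    refine ⟨_, mem _ hw, ?_⟩
    obtain ⟨e₀, e₁, e₂⟩ := e2 (3 * s₀) (3 * s₁) 0
    rw [cand _ hw, e₀, e₁, e₂, c3, c3, c0, norm_sq_fin_three x, hnorm]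
    exact covering_aux (x 0) (x 1) (x 2) d _ _ hs₀x hs₁x hs₀sq hs₁sq hA.1 hA.2 hd
  · have hx' : 0 ≤ x 0 + x 2 + x 1 := by linarith
    have hne := not_both_neg hx' hB.1 hs₀n hs₂n
    obtain ⟨-, hw, -⟩ := three_smul_mem_hcpInt _ _ hs₀ hs₂ hne
    refine ⟨_, mem _ hw, ?_⟩
    obtain ⟨e₀, e₁, e₂⟩ := e2 (3 * s₀) 0 (3 * s₂)
    rw [cand _ hw, e₀, e₁, e₂, c3, c3, c0, norm_sq_fin_three x, hnorm]
    have := covering_aux (x 0) (x 2) (x 1) d _ _ hs₀x hs₂x hs₀sq hs₂sq hB.1 hB.2 hd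
    have hperm : x 0 ^ 2 + x 2 ^ 2 + x 1 ^ 2 = x 0 ^ 2 + x 1 ^ 2 + x 2 ^ 2 := by ring
    rw [hperm] at this
    simp only [mul_zero, sub_zero] at this ⊢
    linarith
  · have hx' : 0 ≤ x 1 + x 2 + x 0 := by linarith
    have hne := not_both_neg hx' hC.1 hs₁n hs₂n
    obtain ⟨-, -, hw⟩ := three_smul_mem_hcpInt _ _ hs₁ hs₂ hne
    refine ⟨_, mem _ hw, ?_⟩
    obtain ⟨e₀, e₁, e₂⟩ := e2 0 (3 * s₁) (3 * s₂)
    rw [cand _ hw, e₀, e₁, e₂, c3, c3, c0, norm_sq_fin_three x, hnorm]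
    have := covering_aux (x 1) (x 2) (x 0) d _ _ hs₁x hs₂x hs₁sq hs₂sq hC.1 hC.2 hd
    have hperm : x 1 ^ 2 + x 2 ^ 2 + x 0 ^ 2 = x 0 ^ 2 + x 1 ^ 2 + x 2 ^ 2 := by ring
    rw [hperm] at this
    simp only [mul_zero, sub_zero] at this ⊢
    linarith

/-- **The mirror in the hexagonal plane**: `σ(x) = x − (2/3)(x₀+x₁+x₂)·(1,1,1)`. [folklore] -/
theorem mirror_props :
    ∃ σ : EuclideanSpace ℝ (Fin 3) →ₗᵢ[ℝ] EuclideanSpace ℝ (Fin 3),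
      (∀ x : EuclideanSpace ℝ (Fin 3), ∀ i, σ x i = x i - 2 / 3 * (x 0 + x 1 + x 2)) ∧
      (∀ x : EuclideanSpace ℝ (Fin 3), σ (σ x) = x) := by
  let L : EuclideanSpace ℝ (Fin 3) →ₗ[ℝ] EuclideanSpace ℝ (Fin 3) :=
    { toFun := fun x => WithLp.toLp 2 fun i => x i - 2 / 3 * (x 0 + x 1 + x 2)
      map_add' := fun x y => by ext i; simp only [PiLp.add_apply]; ring
      map_smul' := fun c x => by ext i; simp only [PiLp.smul_apply, smul_eq_mul, RingHom.id_apply]; ring }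
  have hL : ∀ x i, L x i = x i - 2 / 3 * (x 0 + x 1 + x 2) := fun x i => rfl
  have hnorm : ∀ x, ‖L x‖ = ‖x‖ := by
    intro x
    have h1 : ‖L x‖ ^ 2 = ‖x‖ ^ 2 := by
      rw [norm_sq_fin_three, norm_sq_fin_three, hL, hL, hL]
      ring
    exact (pow_left_inj₀ (norm_nonneg _) (norm_nonneg _) two_ne_zero).1 h1
  refine ⟨⟨L, hnorm⟩, fun x i => hL x i, fun x => ?_⟩
  ext i
  show L (L x) i = x i
  simp only [hL]
  ring

/-- **COVERING CONSTANT OF THE ANTICUBOCTAHEDRON**. [folklore] -/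
theorem hcp_covering (x : EuclideanSpace ℝ (Fin 3)) {d : ℝ} (hd : 0 ≤ d) :
    ∃ u ∈ hcpKissingPattern, ‖x - d • u‖ ^ 2 ≤ ‖x‖ ^ 2 + d ^ 2 - Real.sqrt 2 * d * ‖x‖ := by
  by_cases hx : 0 ≤ x 0 + x 1 + x 2
  · exact hcp_covering_upper x hx hd
  -- lower half-space: reflect
  obtain ⟨σ, hσ, hσσ⟩ := mirror_props
  have hx' : 0 ≤ σ x 0 + σ x 1 + σ x 2 := by rw [hσ, hσ, hσ]; linarith
  obtain ⟨u, hu, hux⟩ := hcp_covering_upper (σ x) hx' hd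
  -- `σ u` is again an hcp vector: compute it on the integer model
  obtain ⟨v, hv, rfl⟩ := Finset.mem_image.1 hu
  refine ⟨σ ((Real.sqrt ((18 : ℕ) : ℝ))⁻¹ • intVec v), ?_, ?_⟩
  · -- membership: `σ(v/√18) = (v − (2/3)(Σv)(1,1,1))/√18`, an hcp vector for every `v ∈ hcpInt`
    have key : ∀ w ∈ hcpInt, (fun i : Fin 3 => w i - 2 * ((w 0 + w 1 + w 2) / 3)) ∈ hcpInt ∧ (3 : ℤ) ∣ (w 0 + w 1 + w 2) := by decide
    obtain ⟨hw, h3⟩ := key v hv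
    have heq : σ ((Real.sqrt ((18 : ℕ) : ℝ))⁻¹ • intVec v) =
        (Real.sqrt ((18 : ℕ) : ℝ))⁻¹ • intVec (fun i : Fin 3 => v i - 2 * ((v 0 + v 1 + v 2) / 3)) := by
      ext i
      obtain ⟨m, hm⟩ := h3
      have hdiv : ((v 0 + v 1 + v 2) / 3 : ℤ) = m := by rw [hm]; simp
      simp only [hσ, hcp_coord, hdiv]
      have hm' : ((v 0 : ℝ) + v 1 + v 2) = 3 * m := by exact_mod_cast hm
      push_cast
      linear_combination (Real.sqrt 2)⁻¹ * (-(2 : ℝ) / 9) * hm'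
    rw [heq]
    exact Finset.mem_image_of_mem _ hw
  · -- the estimate transfers through the involutive isometry
    have h1 : x - d • σ ((Real.sqrt ((18 : ℕ) : ℝ))⁻¹ • intVec v) = σ (σ x - d • ((Real.sqrt ((18 : ℕ) : ℝ))⁻¹ • intVec v)) := by
      simp only [LinearIsometry.map_sub, LinearIsometry.map_smul, hσσ]
    rw [σ.norm_map] at hux
    rw [h1, σ.norm_map]
    exact hux

/-- **KR_gap, hcp instance**. [folklore] -/
theorem thirteenth_neighbour_gap_hcp {p q : EuclideanSpace ℝ (Fin 3)} {d η : ℝ}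
    {A : EuclideanSpace ℝ (Fin 3) →ₗᵢ[ℝ] EuclideanSpace ℝ (Fin 3)} {t : ↥hcpKissingPattern → EuclideanSpace ℝ (Fin 3)}
    (hd : 0 < d) (hη : η ≤ 1 / 20) (ht : ∀ u : ↥hcpKissingPattern, ‖(t u - p) - d • A (u : EuclideanSpace ℝ (Fin 3))‖ ≤ η * d)
    (hq₁ : d ≤ dist q p) (hq₂ : dist q p ≤ 131 / 100 * d) :
    ∃ u : ↥hcpKissingPattern, dist q (t u) < 100 / 101 * d :=
  thirteenth_neighbour_gap (fun x _ hd' => hcp_covering x hd') hd hη ht hq₁ hq₂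

end Summit.AtomisticToContinuum.Crystallization.Theorems.FrustratedLawDichotomyThirteenthNeighbourGapHcp

end
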